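import Summits.CriticalPhenomena.PercolationContinuityZ3.Theorems.PercAnnulusCrossingSetToSetQuasiMultFixedAspect
import Summits.CriticalPhenomena.PercolationContinuityZ3.Theorems.PercAnnulusCrossingSetToSetQuasiMultThinShells
import Summits.CriticalPhenomena.PercolationContinuityZ3.Theorems.PercAnnulusCrossingBoxCrossingDefs
import HarnessLib

/-!
# The domain of the aspect-general Basu–Sapozhnikov Prop: inner aspect `s = 1` is degenerate at `p_c`

builds on p205010 (kernel theorem, internal audit signed; external expert review pending)

RSW3 lane (LANE 3 `prim-rsw3`), lead seat, gen 3.  Helper file (`--supports`); no definitions, no sorries.  Hygiene for the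
lane's defs v5 (`Crossing.SetToSetQuasiMultAspectAt d p s L ϰ`, p220494), whose docstring says the intended domain is
`2 ≤ s < L`: **at `p_c(ℤ^d)`, `d ≥ 2`, the instance `s = 1` FAILS for every `L ≥ 2` and every `ϰ > 0`.**  Witness at scale
`m`: `Z = Λ(Lm+1)`, `X = {−m·e₀} ⊆ ∂ⁱⁿΛ(m)`, `Y = ∂ⁱⁿΛ(Lm+1)`; the `X`-factor is `1` (the source already lies on the middle
sphere `∂ⁱⁿΛ(1·m)`), the `Y`-factor is at least the every-aspect annulus window `(2d)⁻¹(1/(4(L+1)))^{d−1}` (lead gen 1,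
`Rsw3.le_real_boxCrossing_criticalProbI_of_le`), while the conclusion is at most the one-arm probability `π_{p_c}((L−1)m) → 0`
(`θ(p_c) = 0`, p205010 for all `d ≥ 2`).  So consumers must keep `2 ≤ s` (the Basu–Sapozhnikov instance is `(s, L) = (2, 4)`).

* `not_setToSetQuasiMultAspectAt_one` — `¬ SetToSetQuasiMultAspectAt d p_c 1 L ϰ` for `2 ≤ d`, `2 ≤ L`, `0 < ϰ`.
[cite: BasuSapozhnikov2017ECP, §1 assumption (A2)] [cite: Grimmett1999, §1.4]
-/

noncomputable section

namespace Summit.CriticalPhenomena.PercolationContinuityZ3.Theorems.Crossing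

open MeasureTheory Filter Topology
open Literature.Probability.Percolation Literature.Probability.LatticeModels
open Literature.Probability.Percolation.DCT16

variable {d : ℕ}

/-- **Inner aspect `1` is degenerate:** at `p_c(ℤ^d)` (`d ≥ 2`), `SetToSetQuasiMultAspectAt d p_c 1 L ϰ` fails for every `L ≥ 2`,
`ϰ > 0` (witness `Z = Λ(Lm+1)`, `X = {−m·e₀}`, `Y = ∂ⁱⁿΛ(Lm+1)`, `m → ∞`).  The Prop is meant for `2 ≤ s < L`.
[cite: BasuSapozhnikov2017ECP, §1 assumption (A2)] -/
theorem not_setToSetQuasiMultAspectAt_one (hd : 2 ≤ d) {L : ℕ} (hL : 2 ≤ L) {ϰ : ℝ} (hϰ : 0 < ϰ) :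
    ¬ SetToSetQuasiMultAspectAt d (criticalProbI d) 1 L ϰ := by
  intro h
  have hd1 : 1 ≤ d := by omega
  set μ := bondPercolation (zdGraph d) (criticalProbI d) with hμ
  set i₀ : Fin d := ⟨0, hd1⟩ with hi₀
  -- the window constant
  set w : ℝ := (2 * (d : ℝ))⁻¹ * ((1 : ℝ) / (4 * ((L : ℝ) + 1))) ^ (d - 1) with hw
  have hwpos : 0 < w := by positivity
  -- the bound at every scale: `ϰ · w ≤ π((L-1)m)`
  have key : ∀ m : ℕ, 1 ≤ m → ϰ * w ≤ μ.real (siteToBoundary d ((L - 1) * m)) := by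
    intro m hm
    set N : ℕ := L * m + 1 with hN
    set x : Site d := Pi.single i₀ (-(m : ℤ)) with hx
    have hxbd : x ∈ innerBoundary (zdGraph d) (box d m) := by
      rw [hx, hi₀]; exact axisPtZ_neg_mem_innerBoundary hd1 m
    have hxbox : x ∈ box d m := (mem_innerBoundary_iff.1 hxbd).1
    have hmN : m ≤ N := by rw [hN]; nlinarith
    have hLm : L * m < N := by rw [hN]; omega
    set Z : Finset (Site d) := box d N with hZ
    have hZ' : box d (L * m) \ box d (m - 1) ⊆ Z := fun z hz =>
      box_mono d hLm.le (Finset.mem_sdiff.1 hz).1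
    set X : Finset (Site d) := {x} with hX
    have hX' : X ⊆ Z ∩ box d m := by
      rw [hX, Finset.singleton_subset_iff, Finset.mem_inter]
      exact ⟨box_mono d hmN hxbox, hxbox⟩
    set Y : Finset (Site d) := innerBoundary (zdGraph d) (box d N) with hY
    have hY' : Y ⊆ Z \ box d (L * m) := by
      intro y hy
      refine Finset.mem_sdiff.2 ⟨(mem_innerBoundary_iff.1 hy).1, fun hy' => ?_⟩
      obtain ⟨i, hi⟩ := exists_eq_of_mem_innerBoundary_box hy
      have h1 := (mem_box.1 hy') i
      rcases hi with hi | hi <;> rw [hi] at h1 <;> push_cast [hN] at h1 <;> omega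
    have hA2 := h m hm Z hZ' X hX' Y hY'
    -- the `X`-factor is `1`
    have hA : μ.real {ω | ∃ x' ∈ X, ∃ s ∈ innerBoundary (zdGraph d) (box d (1 * m)),
        ω ∈ openConnIn (↑Z : Set (Site d)) x' s} = 1 := by
      have hset : {ω : BondConfig (Site d) | ∃ x' ∈ X, ∃ s ∈ innerBoundary (zdGraph d) (box d (1 * m)),
          ω ∈ openConnIn (↑Z : Set (Site d)) x' s} = Set.univ := by
        refine Set.eq_univ_of_forall fun ω => ⟨x, Finset.mem_singleton_self x, x, by rw [one_mul]; exact hxbd, ?_⟩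
        exact mem_openConnIn_of_pathIn (PathIn.refl (Finset.mem_coe.2 (box_mono d hmN hxbox)))
      rw [hset, probReal_univ]
    -- the `Y`-factor is at least the window
    have hB : w ≤ μ.real {ω | ∃ y ∈ Y, ∃ s ∈ innerBoundary (zdGraph d) (box d (1 * m)),
        ω ∈ openConnIn (↑Z : Set (Site d)) y s} := by
      have hwin := Rsw3.le_real_boxCrossing_criticalProbI_of_le hd hm hmN
      have hZ'' : box d N \ box d (m - 1) ⊆ Z := fun z hz => (Finset.mem_sdiff.1 hz).1
      have hlink := real_boxCrossing_le_real_link_spheres_of_le (criticalProbI d) hm hmN hZ''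
      have hcmp : w ≤ (2 * (d : ℝ))⁻¹ * ((m : ℝ) / (4 * N)) ^ (d - 1) := by
        rw [hw]
        apply mul_le_mul_of_nonneg_left _ (by positivity)
        apply pow_le_pow_left₀ (by positivity)
        rw [div_le_div_iff₀ (by positivity) (by positivity), hN]
        push_cast
        nlinarith [(by exact_mod_cast hm : (1 : ℝ) ≤ m)]
      rw [one_mul]
      exact hcmp.trans (hwin.trans hlink)
    -- the conclusion is at most an arm of length `(L-1)m`
    have hC : μ.real {ω | ∃ x' ∈ X, ∃ y ∈ Y, ω ∈ openConnIn (↑Z : Set (Site d)) x' y} ≤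
        μ.real (siteToBoundary d ((L - 1) * m)) := by
      rw [← real_armEvent (criticalProbI d) x]
      refine real_mono_of_forall_subset_edgeSet (zdGraph d) (criticalProbI d) fun ω hω h' => ?_
      obtain ⟨x', hx', y, hy, hconn⟩ := h'
      rw [hX, Finset.mem_singleton] at hx'
      subst hx'
      refine armEvent_of_pathIn hω (pathIn_of_mem_openConnIn hconn) (Or.inl fun hyx => ?_)
      obtain ⟨i, hi⟩ := exists_eq_of_mem_innerBoundary_box hy
      have h1 := (mem_box.1 hyx) i
      have hL1 : ((L - 1 : ℕ) : ℤ) = (L : ℤ) - 1 := by push_cast [Nat.cast_sub (by omega : 1 ≤ L)]; ring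
      have hsub : (y - x) i = y i - x i := Pi.sub_apply y x i
      rw [hsub] at h1
      have hLm1 : (m : ℤ) ≤ (L : ℤ) * m := by nlinarith
      by_cases hii : i = i₀
      · subst hii
        have hxi : x i₀ = -(m : ℤ) := by rw [hx, Pi.single_eq_same]
        rw [hxi] at h1
        push_cast [hN, hL1] at h1 hi
        rcases hi with hi | hi <;> rw [hi] at h1 <;> nlinarith
      · have hxi : x i = 0 := by rw [hx, Pi.single_eq_of_ne hii]
        rw [hxi, sub_zero] at h1
        push_cast [hN, hL1] at h1 hi
        rcases hi with hi | hi <;> rw [hi] at h1 <;> nlinarith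
    -- combine
    calc ϰ * w = ϰ * (1 * w) := by ring
      _ ≤ ϰ * (μ.real {ω | ∃ x' ∈ X, ∃ s ∈ innerBoundary (zdGraph d) (box d (1 * m)),
              ω ∈ openConnIn (↑Z : Set (Site d)) x' s} *
            μ.real {ω | ∃ y ∈ Y, ∃ s ∈ innerBoundary (zdGraph d) (box d (1 * m)),
              ω ∈ openConnIn (↑Z : Set (Site d)) y s}) := by
          rw [hA]; exact mul_le_mul_of_nonneg_left (mul_le_mul_of_nonneg_left hB zero_le_one) hϰ.le
      _ ≤ μ.real {ω | ∃ x' ∈ X, ∃ y ∈ Y, ω ∈ openConnIn (↑Z : Set (Site d)) x' y} := hA2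
      _ ≤ μ.real (siteToBoundary d ((L - 1) * m)) := hC
  -- `π((L-1)m) → θ(p_c) = 0`
  have hθ : theta (zdGraph d) 0 (criticalProbI d) = 0 := CSH.percolationContinuity_allDimensions d hd
  have hlim : Tendsto (fun m : ℕ => μ.real (siteToBoundary d ((L - 1) * m))) atTop (𝓝 0) := by
    have ht := Literature.Probability.Percolation.tendsto_real_siteToBoundary (d := d) (criticalProbI d)
    rw [hθ] at ht
    have h2 : Tendsto (fun m : ℕ => (L - 1) * m) atTop atTop :=
      tendsto_atTop_atTop.2 fun b => ⟨b, fun a ha => by nlinarith [(by omega : 1 ≤ L - 1)]⟩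
    exact ht.comp h2
  have hle : ϰ * w ≤ 0 := ge_of_tendsto hlim (eventually_atTop.2 ⟨1, fun m hm => key m hm⟩)
  have hpos : 0 < ϰ * w := mul_pos hϰ hwpos
  linarith

end Summit.CriticalPhenomena.PercolationContinuityZ3.Theorems.Crossing

end
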